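import Summits.QuantumAdvantage.QuantumAdvantage.Theorems.HankelLiftBeyondRectanglesForsterCore

/-!
# Forster's Theorem 4.1, part III: quantitative general position (compactness over frames)

Route `route-QuantumAdvantage-HankelLift`; infrastructure toward discharging the named fact
`Literature.Computability.Complexity.ForsterIsotropicPosition` (Forster 2002, Thm 4.1).

`exists_quantGP`: if every sub-family of `u : X → ℝ^k` with at most `k` members is linearly
independent (`k ≥ 1`), there is `δ₀ > 0` with `‖u_x‖² ≥ kδ₀` for all `x` and such that for every
orthonormal basis `(e_j)` of `ℝ^k` and every nonempty `U ⊊ [k]`, at most `k − |U|` indices `x` have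
`⟨e_i, u_x⟩² < δ₀` for all `i ∈ U`.  Proof: for `|T| = k − |U| + 1` the continuous function
`e ↦ ∑_{x∈T} ∑_{i∈U} ⟨e_i,u_x⟩²` is positive on the compact set of orthonormal frames (if it vanished,
the `k+1` vectors `u_x (x ∈ T), e_i (i ∈ U)` would be linearly independent in `ℝ^k`), hence bounded
below by some `m_{U,T} > 0`; take `δ₀` below all `m_{U,T}/k²`.  This is the quantitative form of
general position used in the compactness step (Lemma 4.2) of Forster's proof.
[cite: Forster2002, Lemma 4.2]
-/

set_option linter.dupNamespace false -- D-0017: single-problem summit ⇒ `QuantumAdvantage.QuantumAdvantage` by design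

noncomputable section

namespace Summit.QuantumAdvantage.QuantumAdvantage.Theorems.HankelLift.Forster

open Finset Real Matrix

/-- Orthonormal vectors together with vectors orthogonal to them and linearly independent among
themselves form a linearly independent family. [folklore] -/
theorem linearIndependent_sum_of_orthogonal {k : ℕ} {T U : Type*} [Fintype T] [Fintype U]
    [DecidableEq U] (a : T → Fin k → ℝ) (b : U → Fin k → ℝ) (ha : LinearIndependent ℝ a)
    (hb : ∀ i j, b i ⬝ᵥ b j = if i = j then 1 else 0) (hab : ∀ x i, b i ⬝ᵥ a x = 0) :
    LinearIndependent ℝ (Sum.elim a b) := by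
  classical
  rw [Fintype.linearIndependent_iff]
  intro c hc
  -- split the vanishing combination
  have hsplit : ∑ x, c (Sum.inl x) • a x + ∑ i, c (Sum.inr i) • b i = 0 := by
    rw [← hc, Fintype.sum_sum_type]
    simp only [Sum.elim_inl, Sum.elim_inr]
  -- dot with `b j`: the `b`-coefficients vanish
  have hcb : ∀ j, c (Sum.inr j) = 0 := by
    intro j
    have h := congrArg (fun w => b j ⬝ᵥ w) hsplit
    simp only [dotProduct_add, dotProduct_zero, dotProduct_sum, dotProduct_smul, smul_eq_mul,
      hab, mul_zero, Finset.sum_const_zero, zero_add, hb] at h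
    rw [Finset.sum_eq_single j (fun i _ hij => by simp [Ne.symm hij]) (by simp)] at h
    simpa using h
  -- then the `a`-combination vanishes
  have hca : ∀ x, c (Sum.inl x) = 0 := by
    have h0 : ∑ x, c (Sum.inl x) • a x = 0 := by
      have := hsplit
      simp only [hcb, zero_smul, Finset.sum_const_zero, add_zero] at this
      exact this
    exact Fintype.linearIndependent_iff.mp ha _ h0
  rintro (x | i)
  · exact hca x
  · exact hcb i

/-- The set of orthonormal frames of `ℝ^k` (as `k`-tuples of coordinate vectors) is compact. [folklore] -/
theorem isCompact_orthonormalFrames (k : ℕ) :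
    IsCompact {e : Fin k → Fin k → ℝ | ∀ i j, e i ⬝ᵥ e j = if i = j then 1 else 0} := by
  have hclosed : IsClosed {e : Fin k → Fin k → ℝ | ∀ i j, e i ⬝ᵥ e j = if i = j then 1 else 0} := by
    have : {e : Fin k → Fin k → ℝ | ∀ i j, e i ⬝ᵥ e j = if i = j then 1 else 0} =
        ⋂ i, ⋂ j, {e | e i ⬝ᵥ e j = if i = j then 1 else 0} := by
      ext e; simp
    rw [this]
    refine isClosed_iInter fun i => isClosed_iInter fun j => ?_
    refine isClosed_eq ?_ continuous_const
    simp only [dotProduct]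
    fun_prop
  have hbox : IsCompact (Set.pi Set.univ fun _ : Fin k => Set.pi Set.univ fun _ : Fin k =>
      Set.Icc (-1 : ℝ) 1) :=
    isCompact_univ_pi fun _ => isCompact_univ_pi fun _ => isCompact_Icc
  refine hbox.of_isClosed_subset hclosed ?_
  intro e he
  simp only [Set.mem_setOf_eq] at he
  simp only [Set.mem_pi, Set.mem_univ, true_implies, Set.mem_Icc]
  intro i l
  have h1 : e i ⬝ᵥ e i = 1 := by rw [he i i, if_pos rfl]
  have hsq : e i l ^ 2 ≤ 1 := by
    rw [← h1, dotProduct]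
    calc e i l ^ 2 = e i l * e i l := sq _
      _ ≤ ∑ l', e i l' * e i l' :=
          Finset.single_le_sum (f := fun l' => e i l' * e i l') (fun l' _ => mul_self_nonneg _)
            (Finset.mem_univ l)
  constructor <;> nlinarith [sq_nonneg (e i l)]

/-- **Quantitative general position.**  See the module docstring. [cite: Forster2002, Lemma 4.2] -/
theorem exists_quantGP {X : Type*} [Fintype X] [DecidableEq X] {k : ℕ} (hk : 1 ≤ k)
    (u : X → Fin k → ℝ) (hGP : ∀ S : Finset X, S.card ≤ k → LinearIndepOn ℝ u (S : Set X)) :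
    ∃ δ₀ : ℝ, 0 < δ₀ ∧ (∀ x, (k : ℝ) * δ₀ ≤ u x ⬝ᵥ u x) ∧
      ∀ e : Fin k → Fin k → ℝ, (∀ i j, e i ⬝ᵥ e j = if i = j then 1 else 0) →
        ∀ U : Finset (Fin k), U.Nonempty → U.card < k →
          (Finset.univ.filter fun x => ∀ i ∈ U, (e i ⬝ᵥ u x) ^ 2 < δ₀).card ≤ k - U.card := by
  classical
  set O := {e : Fin k → Fin k → ℝ | ∀ i j, e i ⬝ᵥ e j = if i = j then 1 else 0} with hO
  have hOc : IsCompact O := isCompact_orthonormalFrames k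
  have hOne : O.Nonempty := ⟨fun i => Pi.single i 1, fun i j => by
    show Pi.single i (1 : ℝ) ⬝ᵥ Pi.single j 1 = _
    rw [dotProduct_single, mul_one, Pi.single_apply]
    by_cases h : i = j
    · subst h; simp
    · rw [if_neg (Ne.symm h), if_neg h]⟩
  -- the test functions
  let g : Finset (Fin k) × Finset X → (Fin k → Fin k → ℝ) → ℝ :=
    fun q e => ∑ x ∈ q.2, ∑ i ∈ q.1, (e i ⬝ᵥ u x) ^ 2
  have hgcont : ∀ q, Continuous (g q) := by
    intro q
    simp only [g, dotProduct]
    fun_prop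
  -- positivity on frames, for `|T| + |U| = k + 1`, `|T| ≤ k`
  have hgpos : ∀ q : Finset (Fin k) × Finset X, q.2.card ≤ k → q.2.card + q.1.card = k + 1 →
      ∀ e ∈ O, 0 < g q e := by
    rintro ⟨U, T⟩ hTk hTU e he
    simp only at hTk hTU
    have hnn : 0 ≤ g (U, T) e := Finset.sum_nonneg fun x _ => Finset.sum_nonneg fun i _ => sq_nonneg _
    rcases eq_or_lt_of_le hnn with h0 | hpos
    · exfalso
      -- all inner products vanish
      have hzero : ∀ x ∈ T, ∀ i ∈ U, e i ⬝ᵥ u x = 0 := by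
        intro x hx i hi
        have h1 : ∑ x ∈ T, ∑ i ∈ U, (e i ⬝ᵥ u x) ^ 2 = 0 := h0.symm
        have h2 := (Finset.sum_eq_zero_iff_of_nonneg (fun x _ =>
          Finset.sum_nonneg fun i _ => sq_nonneg _)).mp h1 x hx
        have h3 := (Finset.sum_eq_zero_iff_of_nonneg (fun i _ => sq_nonneg _)).mp h2 i hi
        exact pow_eq_zero_iff (n := 2) (by norm_num) |>.mp h3
      -- the combined family is linearly independent, of size `k + 1`
      have hT : LinearIndependent ℝ (fun x : T => u x) := hGP T hTk
      have hli := linearIndependent_sum_of_orthogonal (fun x : T => u x) (fun i : U => e i) hT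
        (fun i j => by
          rw [he i j]
          by_cases h : i = j
          · subst h; simp
          · have h' : (i : Fin k) ≠ j := fun h'' => h (Subtype.ext h'')
            rw [if_neg h', if_neg h])
        (fun x i => hzero x x.2 i i.2)
      have hcard := hli.fintype_card_le_finrank
      rw [Fintype.card_sum, Fintype.card_coe, Fintype.card_coe, Module.finrank_fin_fun] at hcard
      omega
    · exact hpos
  -- the relevant pairs and their positive minima
  set P : Finset (Finset (Fin k) × Finset X) := (Finset.univ ×ˢ Finset.univ).filter
    fun q => q.2.card ≤ k ∧ q.2.card + q.1.card = k + 1 with hP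
  have hmin : ∀ q ∈ P, ∃ m : ℝ, 0 < m ∧ ∀ e ∈ O, m ≤ g q e := by
    intro q hq
    simp only [hP, Finset.mem_filter, Finset.mem_product, Finset.mem_univ, true_and] at hq
    obtain ⟨e₀, he₀, hle⟩ := hOc.exists_isMinOn hOne (hgcont q).continuousOn
    exact ⟨g q e₀, hgpos q hq.1 hq.2 e₀ he₀, fun e he => hle he⟩
  choose! m hm0 hmle using hmin
  -- a uniform positive lower bound
  obtain ⟨δ₁, hδ₁, hδ₁le⟩ : ∃ δ₁ : ℝ, 0 < δ₁ ∧ ∀ q ∈ P, δ₁ ≤ m q := by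
    rcases P.eq_empty_or_nonempty with hPe | hPne
    · exact ⟨1, one_pos, by simp [hPe]⟩
    · obtain ⟨q₀, hq₀, hq₀min⟩ := Finset.exists_min_image P m hPne
      exact ⟨m q₀, hm0 q₀ hq₀, hq₀min⟩
  -- the norms of the `u_x`
  have hune : ∀ x, 0 < u x ⬝ᵥ u x := by
    intro x
    have h := hGP {x} (by simp; exact hk)
    rw [Finset.coe_singleton] at h
    have hx : u x ≠ 0 := h.ne_zero (Set.mem_singleton x)
    exact lt_of_le_of_ne (Finset.sum_nonneg fun l _ => mul_self_nonneg _)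
      (fun h0 => hx (dotProduct_self_eq_zero.mp h0.symm))
  obtain ⟨c, hc, hcle⟩ : ∃ c : ℝ, 0 < c ∧ ∀ x, c ≤ u x ⬝ᵥ u x := by
    rcases (Finset.univ : Finset X).eq_empty_or_nonempty with hXe | hXne
    · refine ⟨1, one_pos, fun x => ?_⟩
      have hx := Finset.mem_univ x
      rw [hXe] at hx
      exact absurd hx (Finset.notMem_empty x)
    · obtain ⟨x₀, -, hx₀⟩ := Finset.exists_min_image Finset.univ (fun x => u x ⬝ᵥ u x) hXne
      exact ⟨u x₀ ⬝ᵥ u x₀, hune x₀, fun x => hx₀ x (Finset.mem_univ x)⟩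
  -- the constant
  have hkpos : (0 : ℝ) < k := by exact_mod_cast hk
  refine ⟨min (δ₁ / ((k : ℝ) * k + 1)) (c / k), lt_min (by positivity) (by positivity), ?_, ?_⟩
  · intro x
    calc (k : ℝ) * min (δ₁ / ((k : ℝ) * k + 1)) (c / k) ≤ k * (c / k) :=
          mul_le_mul_of_nonneg_left (min_le_right _ _) hkpos.le
      _ = c := by field_simp
      _ ≤ u x ⬝ᵥ u x := hcle x
  · intro e he U hUne hUk
    have hUpos := hUne.card_pos
    by_contra hbad
    rw [not_le] at hbad
    -- pick `T ⊆ Bad` with `|T| = k - |U| + 1`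
    obtain ⟨T, hTsub, hTcard⟩ := Finset.exists_subset_card_eq
      (s := Finset.univ.filter fun x => ∀ i ∈ U, (e i ⬝ᵥ u x) ^ 2 <
        min (δ₁ / ((k : ℝ) * k + 1)) (c / k)) (n := k - U.card + 1) (by omega)
    have hq : (U, T) ∈ P := by
      simp only [hP, Finset.mem_filter, Finset.mem_product, Finset.mem_univ, true_and]
      constructor <;> omega
    have h1 : δ₁ ≤ g (U, T) e := (hδ₁le _ hq).trans (hmle _ hq e he)
    -- but `g (U,T) e < |T| |U| δ₀ ≤ δ₁`
    have h2 : g (U, T) e < δ₁ := by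
      have hUk' : (U.card : ℝ) ≤ k := by exact_mod_cast hUk.le
      have hTk' : (T.card : ℝ) ≤ k := by rw [hTcard]; push_cast; have := hUne.card_pos; 
                                          rw [Nat.cast_sub hUk.le]; linarith [show (1:ℝ) ≤ U.card by exact_mod_cast this]
      calc g (U, T) e = ∑ x ∈ T, ∑ i ∈ U, (e i ⬝ᵥ u x) ^ 2 := rfl
        _ < ∑ x ∈ T, ∑ i ∈ U, δ₁ / ((k : ℝ) * k + 1) := by
            have hTne : T.Nonempty := by rw [← Finset.card_pos, hTcard]; omega
            refine Finset.sum_lt_sum_of_nonempty hTne fun x hx => ?_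
            refine Finset.sum_lt_sum_of_nonempty hUne fun i hi => ?_
            have hx' := (Finset.mem_filter.mp (hTsub hx)).2 i hi
            exact lt_of_lt_of_le hx' (min_le_left _ _)
        _ = T.card * (U.card * (δ₁ / ((k : ℝ) * k + 1))) := by
            rw [Finset.sum_const, nsmul_eq_mul, Finset.sum_const, nsmul_eq_mul]
        _ ≤ k * (k * (δ₁ / ((k : ℝ) * k + 1))) := by
            have hδ' : 0 ≤ δ₁ / ((k : ℝ) * k + 1) := by positivity
            exact mul_le_mul hTk' (mul_le_mul_of_nonneg_right hUk' hδ') (by positivity) hkpos.le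
        _ < δ₁ := by
            rw [← mul_assoc, mul_div_assoc', div_lt_iff₀ (by positivity)]
            nlinarith
    linarith

end Summit.QuantumAdvantage.QuantumAdvantage.Theorems.HankelLift.Forster
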